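import Summits.Ventures.PercRepro.RankLevelSetHallCoopShareLevelBounds
import Summits.Ventures.PercRepro.RankLevelSetHallCoopShareArithK

/-!
# PercRepro — THE RANK-`(q+1)` LEVEL OF THE UP-HALL FORM OF C-044 AT THE TIGHT LAYER, FOR EVERY `k`
(p4, gen 38; paper proofs/P4-KERNEL-A-DEAD.md §4 (ii); the `k = 2` theorem `hallUp_of_ncard_eq_k2` is the case `p = q + 2`)

For a member `Z` of the cell `(p, q)` at the tight layer `#E = p + q` (`k = p − q ≥ 2`), with `F = cl Z`, `D = F ∖ Z`
(`d = #D ≤ q`) and `O = E ∖ F` (`ω = #O = p − d`), the `Y`-sets `R ∪ {o}` (`Z ⊆ R ⊆ F`, `o ∈ O`) are distinct sets of rank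
`q + 1`, `C(d, j)` of them at each level `#R = q + j` for each of the `ω` outside elements, each paying at least
`1 / C(q + j + 1, j + 1)` (`csWeight_insert_ge`); the identity `receipt_bound_k` turns the sum into `≥ p/(q + 1)`
(`level_le_csWeight_recv`).  With the loads (`csWeight_load_le_one`, supported on the sets of rank `q + 1`) the
level-restricted double count `hallUp_level_of_fracMatching` yields **`hallUp_level_of_ncard_eq`**: for every finite
matroid with `#E = p + q`, `q + 2 ≤ p`, and every family `𝒜` of members of the cell `(p, q)`,
`p · #𝒜 ≤ (q + 1) · #{S ∈ upNbhd(𝒜) : r(S) = q + 1}`.  For `k = 2` this is the crux `hallUp_of_ncard_eq_k2`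
(`Φ(q+2, q) = (q+2)/(q+1)`); for `k ≥ 3` it is the bottom-level term `C(p, 1)/C(q+1, 1)` of
`Φ(p, q) = Σ_{t=1}^{k−1} C(p, t)/C(q + t, t)`, the first piece of the UP-Hall form of C-044 proved for every `k`
(`hallUp_level_le_upNbhd` records the weaker consequence `p · #𝒜 ≤ (q + 1) · #upNbhd(𝒜)`).

* `upNbhdLevel` — the UP-neighbours of rank `q + 1`;
* `hallUp_level_of_fracMatching` — the double count for a weight supported on the sets of rank `q + 1`;
* **`level_le_csWeight_recv`** — every member receives at least `p/(q + 1)`;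
* **`hallUp_level_of_ncard_eq`**, `hallUp_level_le_upNbhd`.
Axioms: standard.
-/

namespace PercRepro.Level

open Set Matroid Finset

variable {α : Type} (M : Matroid α) [M.Finite]

/-- The UP-neighbours of `𝒜` of rank exactly `q + 1`. -/
def upNbhdLevel (p q : ℕ) (𝒜 : Set (Set α)) : Set (Set α) :=
  {S | S ∈ upNbhd M p q 𝒜 ∧ M.eRk S = ((q + 1 : ℕ) : ℕ∞)}

omit [M.Finite] in
/-- The rank-`(q+1)` UP-neighbours are UP-neighbours. -/
theorem upNbhdLevel_subset (p q : ℕ) (𝒜 : Set (Set α)) : upNbhdLevel M p q 𝒜 ⊆ upNbhd M p q 𝒜 :=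
  fun _ hS => hS.1

/-- **The level-restricted double count**: weights `w Z S ≥ 0` supported on pairs `Z ⊆ S` with `r(S) = q + 1`, every member
receiving at least `c` over the `Y`-sets, every `Y`-set loaded at most `1` over the members — then
`c · #𝒜 ≤ #{S ∈ upNbhd(𝒜) : r(S) = q + 1}` for every family `𝒜` of members. -/
theorem hallUp_level_of_fracMatching (p q : ℕ) (c : ℚ) (w : Set α → Set α → ℚ) (hnn : ∀ Z S, 0 ≤ w Z S)
    (hsupp : ∀ Z S, w Z S ≠ 0 → Z ⊆ S) (hrank : ∀ Z S, w Z S ≠ 0 → M.eRk S = ((q + 1 : ℕ) : ℕ∞))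
    (hdem : ∀ Z ∈ cellMembers M p q, c ≤ ∑ S ∈ (cellY_finite M p q).toFinset, w Z S)
    (hcap : ∀ S ∈ cellY M p q, ∑ Z ∈ (cellMembers_finite M p q).toFinset, w Z S ≤ 1)
    (𝒜 : Set (Set α)) (h𝒜 : 𝒜 ⊆ cellMembers M p q) :
    c * (𝒜.ncard : ℚ) ≤ ((upNbhdLevel M p q 𝒜).ncard : ℚ) := by
  classical
  have h𝒜fin : 𝒜.Finite := (cellMembers_finite M p q).subset h𝒜
  set 𝒜f : Finset (Set α) := h𝒜fin.toFinset with h𝒜f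
  set Yf : Finset (Set α) := (cellY_finite M p q).toFinset with hYf
  set Mf : Finset (Set α) := (cellMembers_finite M p q).toFinset with hMf
  have h𝒜card : (𝒜.ncard : ℚ) = (𝒜f.card : ℚ) := by
    rw [h𝒜f, ncard_eq_toFinset_card _ h𝒜fin]
  have h𝒜M : 𝒜f ⊆ Mf := by
    intro Z hZ
    rw [h𝒜f, h𝒜fin.mem_toFinset] at hZ
    rw [hMf, (cellMembers_finite M p q).mem_toFinset]
    exact h𝒜 hZ
  -- step 1: c·#𝒜 ≤ Σ_{Z ∈ 𝒜} Σ_S w Z S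
  have h1 : c * (𝒜f.card : ℚ) ≤ ∑ Z ∈ 𝒜f, ∑ S ∈ Yf, w Z S := by
    rw [mul_comm, ← nsmul_eq_mul, ← Finset.sum_const]
    refine Finset.sum_le_sum (fun Z hZ => ?_)
    rw [h𝒜f, h𝒜fin.mem_toFinset] at hZ
    exact hdem Z (h𝒜 hZ)
  -- step 2: each S contributes at most the indicator of «S has rank q + 1 and contains a member of 𝒜»
  have h3 : ∀ S ∈ Yf, ∑ Z ∈ 𝒜f, w Z S
      ≤ (if (∃ Z ∈ 𝒜, Z ⊆ S) ∧ M.eRk S = ((q + 1 : ℕ) : ℕ∞) then (1 : ℚ) else 0) := by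
    intro S hS
    rw [hYf, (cellY_finite M p q).mem_toFinset] at hS
    by_cases hex : (∃ Z ∈ 𝒜, Z ⊆ S) ∧ M.eRk S = ((q + 1 : ℕ) : ℕ∞)
    · rw [if_pos hex]
      calc ∑ Z ∈ 𝒜f, w Z S ≤ ∑ Z ∈ Mf, w Z S :=
            Finset.sum_le_sum_of_subset_of_nonneg h𝒜M (fun Z _ _ => hnn Z S)
        _ ≤ 1 := hcap S hS
    · rw [if_neg hex]
      apply le_of_eq
      apply Finset.sum_eq_zero
      intro Z hZ
      rw [h𝒜f, h𝒜fin.mem_toFinset] at hZ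
      by_contra hne
      exact hex ⟨⟨Z, hZ, hsupp Z S hne⟩, hrank Z S hne⟩
  -- step 3: the indicators sum to the size of the rank-(q+1) UP-neighbourhood
  have h4 : ∑ S ∈ Yf, (if (∃ Z ∈ 𝒜, Z ⊆ S) ∧ M.eRk S = ((q + 1 : ℕ) : ℕ∞) then (1 : ℚ) else 0)
      = ((upNbhdLevel M p q 𝒜).ncard : ℚ) := by
    rw [Finset.sum_ite, Finset.sum_const_zero, add_zero, Finset.sum_const, nsmul_eq_mul, mul_one]
    have hU : upNbhdLevel M p q 𝒜
        = ((Yf.filter (fun S => (∃ Z ∈ 𝒜, Z ⊆ S) ∧ M.eRk S = ((q + 1 : ℕ) : ℕ∞)) : Finset (Set α)) : Set (Set α)) := by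
      ext S
      rw [Finset.coe_filter, hYf, Set.mem_setOf_eq, (cellY_finite M p q).mem_toFinset]
      constructor
      · intro hS
        exact ⟨⟨hS.1.1, hS.1.2.1, hS.1.2.2.1⟩, hS.1.2.2.2, hS.2⟩
      · intro hS
        exact ⟨⟨hS.1.1, hS.1.2.1, hS.1.2.2, hS.2.1⟩, hS.2.2⟩
    rw [hU, ncard_coe_finset]
  calc c * (𝒜.ncard : ℚ) = c * (𝒜f.card : ℚ) := by rw [h𝒜card]
    _ ≤ ∑ Z ∈ 𝒜f, ∑ S ∈ Yf, w Z S := h1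
    _ = ∑ S ∈ Yf, ∑ Z ∈ 𝒜f, w Z S := Finset.sum_comm
    _ ≤ ∑ S ∈ Yf, (if (∃ Z ∈ 𝒜, Z ⊆ S) ∧ M.eRk S = ((q + 1 : ℕ) : ℕ∞) then (1 : ℚ) else 0) :=
        Finset.sum_le_sum h3
    _ = ((upNbhdLevel M p q 𝒜).ncard : ℚ) := h4

/-- **Every member receives at least `p/(q+1) = (q + k)/(q + 1)`** from the rank-`(q+1)` sets under the coloop-share kernel
at the tight layer: the sets `R ∪ {o}` (`Z ⊆ R ⊆ cl Z`, `o ∉ cl Z`) are distinct `Y`-sets of rank `q + 1`, each paying at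
least `1 / C(q + j + 1, j + 1)` (`#R = q + j`), and there are `C(d, j)` of them at level `j` for each of the `ω = p − d`
outside elements; `receipt_bound_k` does the arithmetic. -/
theorem level_le_csWeight_recv (p q : ℕ) (hp : q + 2 ≤ p) (hE : M.E.ncard = p + q) {Z : Set α}
    (hZ : Z ∈ cellMembers M p q) :
    (p : ℚ) / ((q : ℚ) + 1) ≤ ∑ S ∈ (cellY_finite M p q).toFinset, csWeight M p q Z S := by
  classical
  have hZE : Z ⊆ M.E := hZ.1
  have hZq : Z.ncard = q := ncard_eq_q_of_mem_cellMembers_tight M hE hZ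
  set F : Set α := M.closure Z with hF
  have hFE : F ⊆ M.E := M.closure_subset_ground Z
  have hZF : Z ⊆ F := M.subset_closure Z hZE
  set D : Set α := F \ Z with hD
  set O : Set α := M.E \ F with hO
  have hEfin : M.E.Finite := M.set_finite M.E
  have hFfin : F.Finite := hEfin.subset hFE
  have hDfin : D.Finite := hFfin.subset sdiff_subset
  have hOfin : O.Finite := hEfin.subset sdiff_subset
  -- d ≤ q: D is independent (inside E ∖ Z) and lies in the rank-q flat F
  have hDind : M.Indep D := (compl_indep_of_mem_U M hE hZ).1.subset (fun x hx => ⟨hFE hx.1, hx.2⟩)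
  have hd_le : D.ncard ≤ q := by
    have h := hDind.encard_le_eRk_of_subset (sdiff_subset : D ⊆ F)
    rw [hF, M.eRk_closure_eq, eRk_eq_of_mem_cellMembers M p q hZ, ← hDfin.cast_ncard_eq] at h
    exact_mod_cast h
  -- ω = q + 2 − d
  have hFcard : F.ncard = q + D.ncard := by
    have := Set.ncard_sdiff_add_ncard_of_subset hZF hFfin
    rw [← hD, hZq] at this
    omega
  have hOcard : O.ncard = p - D.ncard := by
    have := Set.ncard_sdiff_add_ncard_of_subset hFE hEfin
    rw [← hO, hE, hFcard] at this
    omega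
  set Df : Finset α := hDfin.toFinset with hDf
  set Of : Finset α := hOfin.toFinset with hOf
  have hDcard : Df.card = D.ncard := by rw [hDf, ← ncard_eq_toFinset_card _ hDfin]
  have hOcard' : Of.card = O.ncard := by rw [hOf, ← ncard_eq_toFinset_card _ hOfin]
  set Yf : Finset (Set α) := (cellY_finite M p q).toFinset with hYf
  have hmemY : ∀ S, S ∈ Yf ↔ S ∈ cellY M p q := fun S => by
    rw [hYf, (cellY_finite M p q).mem_toFinset]
  -- the pairs (Y', o) and the map φ
  set P : Finset (Finset α × α) := Df.powerset ×ˢ Of with hP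
  let φ : Finset α × α → Set α := fun pr => insert pr.2 (Z ∪ (pr.1 : Set α))
  have hpair : ∀ pr ∈ P, (pr.1 : Set α) ⊆ D ∧ pr.2 ∈ M.E ∧ pr.2 ∉ F := by
    intro pr hpr
    rw [hP, Finset.mem_product, Finset.mem_powerset] at hpr
    obtain ⟨h1, h2⟩ := hpr
    refine ⟨?_, ?_, ?_⟩
    · intro x hx
      have := h1 (Finset.mem_coe.1 hx)
      rw [hDf, Set.Finite.mem_toFinset] at this
      exact this
    · rw [hOf, Set.Finite.mem_toFinset] at h2
      exact h2.1
    · rw [hOf, Set.Finite.mem_toFinset] at h2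
      exact h2.2
  have hR : ∀ pr ∈ P, Z ⊆ Z ∪ (pr.1 : Set α) ∧ Z ∪ (pr.1 : Set α) ⊆ F := by
    intro pr hpr
    obtain ⟨h1, -, -⟩ := hpair pr hpr
    exact ⟨Set.subset_union_left, Set.union_subset hZF (h1.trans sdiff_subset)⟩
  have hRcard : ∀ pr ∈ P, (Z ∪ (pr.1 : Set α)).ncard = q + pr.1.card := by
    intro pr hpr
    obtain ⟨h1, -, -⟩ := hpair pr hpr
    have hdisj : Disjoint Z (pr.1 : Set α) := by
      rw [Set.disjoint_left]
      intro x hxZ hxY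
      exact (h1 hxY).2 hxZ
    rw [Set.ncard_union_eq hdisj (M.set_finite Z hZE) (Finset.finite_toSet _), hZq, ncard_coe_finset]
  -- the image lies in Yf
  have himage : P.image φ ⊆ Yf := by
    intro S hS
    rw [Finset.mem_image] at hS
    obtain ⟨pr, hpr, rfl⟩ := hS
    obtain ⟨-, ho, hocl⟩ := hpair pr hpr
    obtain ⟨hZR, hRcl⟩ := hR pr hpr
    rw [hmemY]
    exact mem_cellY_insert M p q hp hZ hZR hRcl ho hocl
  -- φ is injective on P
  have hinj : ∀ pr ∈ P, ∀ pr' ∈ P, φ pr = φ pr' → pr = pr' := by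
    intro pr hpr pr' hpr' heq
    obtain ⟨h1, -, hocl⟩ := hpair pr hpr
    obtain ⟨h1', -, hocl'⟩ := hpair pr' hpr'
    obtain ⟨hZR, hRcl⟩ := hR pr hpr
    obtain ⟨hZR', hRcl'⟩ := hR pr' hpr'
    obtain ⟨hs1, hs2⟩ := insert_sdiff_closure_eq M Z _ hRcl hocl
    obtain ⟨hs1', hs2'⟩ := insert_sdiff_closure_eq M Z _ hRcl' hocl'
    have ho : pr.2 = pr'.2 := by
      have : ({pr.2} : Set α) = {pr'.2} := by
        rw [← hs1, ← hs1']
        show φ pr \ M.closure Z = φ pr' \ M.closure Z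
        rw [heq]
      exact Set.singleton_eq_singleton_iff.1 this
    have hY : pr.1 = pr'.1 := by
      have hU : Z ∪ (pr.1 : Set α) = Z ∪ (pr'.1 : Set α) := by
        rw [← hs2, ← hs2']
        show φ pr ∩ M.closure Z = φ pr' ∩ M.closure Z
        rw [heq]
      have hdiff : ∀ (Y : Finset α), (Y : Set α) ⊆ D → (Z ∪ (Y : Set α)) \ Z = (Y : Set α) := by
        intro Y hY
        ext x
        simp only [Set.mem_sdiff, Set.mem_union]
        constructor
        · rintro ⟨h | h, hx⟩
          · exact absurd h hx
          · exact h
        · intro h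
          exact ⟨Or.inr h, (hY h).2⟩
      have : (pr.1 : Set α) = (pr'.1 : Set α) := by
        rw [← hdiff pr.1 h1, ← hdiff pr'.1 h1', hU]
      exact Finset.coe_injective this
    exact Prod.ext hY ho
  -- the sum over Yf dominates the sum over the image, which is the sum over the pairs
  have hstep1 : ∑ S ∈ P.image φ, csWeight M p q Z S ≤ ∑ S ∈ Yf, csWeight M p q Z S :=
    Finset.sum_le_sum_of_subset_of_nonneg himage (fun S _ _ => csWeight_nonneg M p q Z S)
  have hstep2 : ∑ S ∈ P.image φ, csWeight M p q Z S = ∑ pr ∈ P, csWeight M p q Z (φ pr) :=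
    Finset.sum_image hinj
  -- each pair pays at least 1 / C(q + #Y' + 1, #Y' + 1)
  have hstep3 : ∑ pr ∈ P, (1 / (((q + pr.1.card + 1).choose (pr.1.card + 1) : ℕ) : ℚ))
      ≤ ∑ pr ∈ P, csWeight M p q Z (φ pr) := by
    apply Finset.sum_le_sum
    intro pr hpr
    obtain ⟨-, ho, hocl⟩ := hpair pr hpr
    obtain ⟨hZR, hRcl⟩ := hR pr hpr
    have h := csWeight_insert_ge M p q hp hE hZ hZR hRcl ho hocl
    rw [hRcard pr hpr, Nat.add_sub_cancel_left] at h
    exact h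
  -- evaluate the pair sum: Σ_{Y'} Σ_o = #Of · Σ_{Y'} 1/C(q + #Y' + 1, #Y' + 1) = ω · Σ_j C(d, j)/C(q+j+1, j+1)
  have hstep4 : ∑ pr ∈ P, (1 / (((q + pr.1.card + 1).choose (pr.1.card + 1) : ℕ) : ℚ))
      = (Of.card : ℚ) * ∑ j ∈ Finset.range (Df.card + 1),
          ((Df.card.choose j : ℕ) : ℚ) * (1 / (((q + j + 1).choose (j + 1) : ℕ) : ℚ)) := by
    rw [hP, Finset.sum_product]
    simp only [Finset.sum_const, nsmul_eq_mul]
    rw [← Finset.mul_sum]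
    congr 1
    rw [Finset.sum_powerset_apply_card (fun m => (1 / (((q + m + 1).choose (m + 1) : ℕ) : ℚ)))]
    apply Finset.sum_congr rfl
    intro j _
    rw [nsmul_eq_mul]
  -- the arithmetic bound, with k = p − q
  have hpq : (q : ℚ) + ((p - q : ℕ) : ℚ) = (p : ℚ) := by
    rw [Nat.cast_sub (by omega)]
    ring
  have harith := CoopShare.receipt_bound_k q D.ncard (p - q) hd_le (by omega)
  rw [hpq] at harith
  have hOq : (Of.card : ℚ) = (p : ℚ) - (D.ncard : ℚ) := by
    rw [hOcard', hOcard, Nat.cast_sub (by omega)]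
  calc (p : ℚ) / ((q : ℚ) + 1)
      ≤ ((p : ℚ) - D.ncard) * ∑ j ∈ Finset.range (D.ncard + 1),
          (D.ncard.choose j : ℚ) / ((q + j + 1).choose (j + 1) : ℚ) := harith
    _ = (Of.card : ℚ) * ∑ j ∈ Finset.range (Df.card + 1),
          ((Df.card.choose j : ℕ) : ℚ) * (1 / (((q + j + 1).choose (j + 1) : ℕ) : ℚ)) := by
        rw [hOq, hDcard]
        congr 1
        apply Finset.sum_congr rfl
        intro j _
        rw [mul_one_div]
    _ = ∑ pr ∈ P, (1 / (((q + pr.1.card + 1).choose (pr.1.card + 1) : ℕ) : ℚ)) := hstep4.symm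
    _ ≤ ∑ pr ∈ P, csWeight M p q Z (φ pr) := hstep3
    _ = ∑ S ∈ P.image φ, csWeight M p q Z S := hstep2.symm
    _ ≤ ∑ S ∈ Yf, csWeight M p q Z S := hstep1

/-- **THE RANK-`(q+1)` LEVEL OF THE UP-HALL FORM OF C-044 AT THE TIGHT LAYER, EVERY `k`**: for every finite matroid with
`#E = p + q`, `q + 2 ≤ p`, and every family `𝒜` of members of the cell `(p, q)`, `(p/(q+1)) · #𝒜 ≤ #{S ∈ upNbhd(𝒜) : r(S) = q + 1}`
— the level-restricted double count applied to the coloop-share kernel (loads `≤ 1`, receipts `≥ p/(q+1)`). -/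
theorem hallUp_level_of_ncard_eq (p q : ℕ) (hp : q + 2 ≤ p) (hE : M.E.ncard = p + q) (𝒜 : Set (Set α))
    (h𝒜 : 𝒜 ⊆ cellMembers M p q) :
    (p : ℚ) / ((q : ℚ) + 1) * (𝒜.ncard : ℚ) ≤ ((upNbhdLevel M p q 𝒜).ncard : ℚ) :=
  hallUp_level_of_fracMatching M p q ((p : ℚ) / ((q : ℚ) + 1)) (csWeight M p q) (csWeight_nonneg M p q)
    (subset_of_csWeight_ne_zero M p q) (fun _ _ h => eRk_eq_of_csWeight_ne_zero M p q h)
    (fun _ hZ => level_le_csWeight_recv M p q hp hE hZ) (fun _ hS => csWeight_load_le_one M p q hS) 𝒜 h𝒜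

/-- The weaker consequence on the whole UP-neighbourhood: `(p/(q+1)) · #𝒜 ≤ #upNbhd(𝒜)` (at `k = 2` this is the crux
`hallUp_of_ncard_eq_k2`, at `k ≥ 3` the bottom-level term of `Φ(p, q)`). -/
theorem hallUp_level_le_upNbhd (p q : ℕ) (hp : q + 2 ≤ p) (hE : M.E.ncard = p + q) (𝒜 : Set (Set α))
    (h𝒜 : 𝒜 ⊆ cellMembers M p q) :
    (p : ℚ) / ((q : ℚ) + 1) * (𝒜.ncard : ℚ) ≤ ((upNbhd M p q 𝒜).ncard : ℚ) := by
  have h := hallUp_level_of_ncard_eq M p q hp hE 𝒜 h𝒜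
  have hfin : (upNbhd M p q 𝒜).Finite := (cellY_finite M p q).subset (upNbhd_subset_cellY 𝒜 p q)
  have hle : (upNbhdLevel M p q 𝒜).ncard ≤ (upNbhd M p q 𝒜).ncard :=
    Set.ncard_le_ncard (upNbhdLevel_subset M p q 𝒜) hfin
  calc (p : ℚ) / ((q : ℚ) + 1) * (𝒜.ncard : ℚ) ≤ ((upNbhdLevel M p q 𝒜).ncard : ℚ) := h
    _ ≤ ((upNbhd M p q 𝒜).ncard : ℚ) := by exact_mod_cast hle

end PercRepro.Level
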